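import Summits.BirchSwinnertonDyer.BirchSwinnertonDyer.Theorems.AdditiveKolyvaginRoadLevelDefs
import Summits.BirchSwinnertonDyer.BirchSwinnertonDyer.Theorems.KolyvaginRoadThreeMethod2LevelSystems
import HarnessLib

/-!
# Route `AdditiveKolyvaginRoad`, crux `KolyvaginPrimitiveAdditive` (item stmt-BirchSwinnertonDyer-20132):
# the vocabulary of the S2 re-line at a GENERAL prime `p` — the TRANSVERSE local condition at a Kolyvagin prime and
# W. Zhang's LEVEL KOLYVAGIN SYSTEMS over the p-generic canonical spaces, as pinned-shape data
# (cell `pub/bsd-wall`, lead prover `bsd-wall-akr-p1` g2; definitions, `--supports stmt-BirchSwinnertonDyer-20132`;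
# the `p`-generic companion of zhang3-p1's `Theorems/KolyvaginRoadThreeMethod2LevelSystems.lean`)

WHY THIS FILE. Stub A1 of the registered skeleton of crux 20132 (rank lowering at Bertolini–Darmon admissible primes)
is LANDED (`Theorems/AdditiveKolyvaginRoadKolyvaginPrimitiveAdditiveRankLowering.lean`, akr-p1 g2); the remaining stub
above the bottom, S2 `stub_inductionGivenRankLoweringAdditive` (W. Zhang's induction GIVEN (A1): odd Selmer rank `≥ 3`
⟹ the crux), is the crux on its slice until it is fed W. Zhang's LEVEL KOLYVAGIN SYSTEMS — the honest residual above the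
bottom. This file types them at a general prime `p`, over the tree's `p`-generic objects of
`AdditiveKolyvaginRoadLevelDefs` (`Vp`, `AdmQ`, `SelQP`, `baseLocusQP`, the TORIC condition `toricLocalKer`), so that
S2 can be re-cut into S2-KS (`Nonempty (LevelKolyvaginSystemP …)`, the open mathematics: Zhang §3 + Thm 4.3 + Thm 7.2
at `p² ∣ N`) and S2-ENGINE (the p-uniform induction engine `ZhangTriangulation.exists_ne_zero_of_zhangInduction_on_of_
kolyvaginSystem_finite` instantiated; provable). Vocabulary only (no mathematics is asserted). Two objects, bodies =
zhang3-p1's with `3 ↦ p`, unipotent-admissible ↦ BD-admissible (no «good level» relativisation: `p ∤ q² − 1` forces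
`Frob_q² ≠ 1`), ordinary ↦ TORIC:

* `transverseLocalKerP W K p ι ℓ v ≤ H¹(K, E[p])` — the classes whose localisation at the place `v ∋ ℓ` is TRANSVERSE
  (W. Zhang 2014 §8.1: `H¹(K_ℓ, V) = H¹_fin ⊕ H¹_tr`, the transverse part inflated from the completed ring class field
  `K[ℓ]_λ/K_λ`), in the tree's GLOBAL Gross-currency: `x` is transverse at `v` iff its cocycle value `h1Eval` vanishes
  at every `d` in the decomposition group of a prime `𝔓 ∣ v` of `\bar ℤ_K`, in `Gal(K̄/K[ℓ])` (`ringClassStabilizer`)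
  and in `Gal(K̄/K(E[p]))`.
* `LevelKolyvaginSystemP W K p Dt β ι c` — classes `κ m n ∈ H¹(K, E[p])` for `m` a finite set of Kolyvagin primes
  (`Zhang2014.IsKolyvaginPrime … p`) and `n` a finite set of BD-admissible primes (`AdmQ W K p`), a sign per level, with:
  REALISATION at `n = ∅` (the frame's Kolyvagin classes mod `p`); at every NON-EMPTY level the KOLYVAGIN-SYSTEM
  AXIOMS for the level-`n` structure [Zhang §8.1 property (1) + (8.1): sign; E's Kummer condition at the infinite places
  and at the finite places above no prime of `m ∪ n`; TORIC at the places of `n`; TRANSVERSE at the places of `m`;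
  `loc_ℓ κ(mℓ, n) = 0 ⟺ loc_ℓ κ(m, n) = 0`]; (A2) congruence TRANSPORT along two steps [Thm 4.3]; (A5) BASE CASE at
  non-empty even levels of canonical rank one [Thm 7.2]. Exactly the level-DEPENDENT binders of the engine-of-KS;
  `Nonempty (LevelKolyvaginSystemP …)` at every ♯ additive frame is the proposed S2-KS — NOT in print at `p² ∣ N`.

HONEST FRAMING: definitions with bodies + one unfolding lemma; 0 named facts, 0 `sorry`, no instance, no notation;
nothing is asserted to exist; closes nothing.

References: [cite: WZhang2014, §3.7 (3.20)–(3.22), §8.1 property (1), (8.1), Def. 8.3, Thm. 4.3, Thm. 7.2, §9]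
[cite: GrossLMS1991, §3 (K_ℓ totally ramified at λ), §4 (4.4), Prop. 6.2] [cite: McCallumLMS1991, §4 (H¹_f ⊕ H¹_s)]
[cite: BertoliniDarmon2005, p. 18, §2.2–§2.3].
-/

-- single-conjunct summit: `Summit.BirchSwinnertonDyer.BirchSwinnertonDyer.…` repeats the name by design
set_option linter.dupNamespace false

noncomputable section

open scoped Classical

namespace Summit.BirchSwinnertonDyer.BirchSwinnertonDyer.Theorems.AdditiveKoly

open WeierstrassCurve NumberField IsDedekindDomain
  Literature.NumberTheory.EllipticCurves Literature.NumberTheory.EllipticCurves.ModularForms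
  Literature.NumberTheory.GaloisRepresentations Module

variable (W : WeierstrassCurve ℚ) (K : Type) [Field K] [NumberField K] (p : ℕ)

/-- **The TRANSVERSE local condition at `ℓ`, general `p`** (W. Zhang 2014, §8.1: `H¹_tr(K_ℓ, V) ⊂ H¹(K_ℓ, V)`, the
classes inflated from the completed ring class field `K[ℓ]_λ/K_λ`; Gross 1991 §3: `λ` is totally ramified in `K[ℓ]`):
the subgroup of `H¹(K, E[p])` of classes `x` whose cocycle value `[x, d]` (tree `h1Eval`) vanishes at every
`d ∈ Gal(K̄/K)` lying in the decomposition group of a prime `𝔓 ∣ v` of `\bar ℤ_K`, in `Gal(K̄/K[ℓ])` (tree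
`ringClassStabilizer K ι ℓ ℓ`) and in `Gal(K̄/K(E[p]))`. Meant for `v` the place of a Kolyvagin prime `ℓ`; junk
elsewhere. (Body = zhang3-p1's `Method2.transverseLocalKer` with `3 ↦ p`.) [cite: WZhang2014, §8.1 (H¹_tr)]
[cite: GrossLMS1991, §3–§4] -/
def transverseLocalKerP (ι : K →+* ℂ) (ℓ : ℕ) (v : HeightOneSpectrum (𝓞 K)) : AddSubgroup (Vp W K p) where
  carrier := {x | ∀ 𝔓 ∈ v.primesAbove, ∀ d : Field.absoluteGaloisGroup K,
    d ∈ 𝔓.decompositionSubgroup (Field.absoluteGaloisGroup K) → d ∈ ringClassStabilizer K ι ℓ ℓ →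
    d ∈ torsionFixing (W.baseChange K) ((p ^ 1 : ℕ) : ℤ) →
    h1Eval (W.baseChange K) ((p ^ 1 : ℕ) : ℤ) x d = 0}
  zero_mem' := fun _ _ _ _ _ hd ↦ h1Eval_zero (W.baseChange K) _ hd
  add_mem' := fun {x y} hx hy 𝔓 h𝔓 d hdD hdS hdT ↦ by
    rw [h1Eval_add (W.baseChange K) _ x y hdT, hx 𝔓 h𝔓 d hdD hdS hdT, hy 𝔓 h𝔓 d hdD hdS hdT, add_zero]
  neg_mem' := fun {x} hx 𝔓 h𝔓 d hdD hdS hdT ↦ by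
    rw [h1Eval_neg (W.baseChange K) _ x hdT, hx 𝔓 h𝔓 d hdD hdS hdT, neg_zero]

variable {W K p} in
/-- Membership in the transverse condition (definitional). [cite: WZhang2014, §8.1 (H¹_tr)] -/
theorem mem_transverseLocalKerP_iff {ι : K →+* ℂ} {ℓ : ℕ} {v : HeightOneSpectrum (𝓞 K)} {x : Vp W K p} :
    x ∈ transverseLocalKerP W K p ι ℓ v ↔ ∀ 𝔓 ∈ v.primesAbove, ∀ d : Field.absoluteGaloisGroup K,
      d ∈ 𝔓.decompositionSubgroup (Field.absoluteGaloisGroup K) → d ∈ ringClassStabilizer K ι ℓ ℓ →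
      d ∈ torsionFixing (W.baseChange K) ((p ^ 1 : ℕ) : ℤ) →
      h1Eval (W.baseChange K) ((p ^ 1 : ℕ) : ℤ) x d = 0 :=
  Iff.rfl

variable [W.IsElliptic] [W.IsGloballyMinimal] [NeZero (W.conductorNorm ℤ)] [Fact p.Prime]
  (Dt : ModularParametrizationData W (W.conductorNorm ℤ)) (β : ℤ) (ι : K →+* ℂ) (c : K ≃ₐ[ℚ] K)
  [Module (ZMod p) (Vp W K p)]

/-- **W. Zhang's LEVEL KOLYVAGIN SYSTEMS at a general prime `p` as pinned-shape data** (the body of the proposed residual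
stub S2-KS of the S2 re-line of crux 20132). Indices: `m` a finite set of Kolyvagin primes (`Zhang2014.IsKolyvaginPrime`,
conductor `∏ m`), `n` a finite set of Bertolini–Darmon admissible primes (`AdmQ W K p`, level `N·∏ n`). Fields: the
classes `κ m n ∈ H¹(K, E[p])` (Zhang's `c(∏m, ∏n)`, (3.30)) and level signs `ε₀`; `realisation` (at level `∅` the
classes ARE the frame's Kolyvagin classes mod `p`); at every NON-EMPTY level the Kolyvagin-system axioms for the
level-`n` structure — `sign`, `selmer_off` ∕ `selmer_inf` ∕ `toric_on` (property (1) off the support: E's Kummer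
condition off `m ∪ n`, the TORIC condition on `n` = the conditions of `levelSelmerSubgroupP`), `transverse_on` (property
(1) on the support), `relation` ((8.1) as used); `transport` ((A2), Thm 4.3, contrapositive transport form of the
engine); `baseCase` ((A5), Thm 7.2 at non-empty even levels of canonical rank one, bottom conductor `m = ∅`). (Body =
zhang3-p1's `Method2.LevelKolyvaginSystem` with `3 ↦ p`, `GoodLevel` dropped, ordinary ↦ toric.) Existence is NOT
claimed. [cite: WZhang2014, §3.9 (3.30), §8.1, Thm. 4.3, Thm. 7.2, §9] [cite: BertoliniDarmon2005, §2.2–§2.3] -/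
structure LevelKolyvaginSystemP where
  /-- the sign of the conductor-one class at level `n` (`c(1, n) ∈ H¹(K, V)^{ε₀ n}`) -/
  ε₀ : Finset (AdmQ W K p) → Bool
  /-- the classes `c(∏ m, ∏ n) ∈ H¹(K, E[p])` -/
  κ : Finset {ℓ // Zhang2014.IsKolyvaginPrime (W.conductorNorm ℤ) W K p ℓ} → Finset (AdmQ W K p) → Vp W K p
  /-- REALISATION: at level `∅` the classes are the frame's Kolyvagin classes mod `p` (for some Kolyvagin–Heegner datum
  of conductor `∏ m`). -/
  realisation : ∀ m : Finset {ℓ // Zhang2014.IsKolyvaginPrime (W.conductorNorm ℤ) W K p ℓ},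
    ∃ d : KolyvaginHeegnerData Dt β ι (∏ ℓ ∈ m, (ℓ : ℕ)),
    κ m ∅ = d.kolyvaginClass (Fact.out : p.Prime) 1
  /-- SIGN: `κ m n` lies in the `ε₀ n · (−1)^{#m}`-eigenspace of complex conjugation. -/
  sign : ∀ n : Finset (AdmQ W K p), n.Nonempty →
    ∀ m : Finset {ℓ // Zhang2014.IsKolyvaginPrime (W.conductorNorm ℤ) W K p ℓ},
    conjAct W c ((p ^ 1 : ℕ) : ℤ) (κ m n) = sgnP (ε₀ n ^^ Nat.bodd m.card) • κ m n
  /-- property (1) off the support, finite places: E's Kummer condition above no prime of `m ∪ n`. -/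
  selmer_off : ∀ n : Finset (AdmQ W K p), n.Nonempty →
    ∀ (m : Finset {ℓ // Zhang2014.IsKolyvaginPrime (W.conductorNorm ℤ) W K p ℓ}) (v : HeightOneSpectrum (𝓞 K)),
    (∀ ℓ ∈ m, ((ℓ : ℕ) : 𝓞 K) ∉ v.asIdeal) → (∀ q ∈ n, ((q : ℕ) : 𝓞 K) ∉ v.asIdeal) →
    κ m n ∈ selmerLocalKer (W.baseChange K) (v.adicCompletion K) ((p ^ 1 : ℕ) : ℤ)
  /-- property (1) off the support, infinite places. -/
  selmer_inf : ∀ n : Finset (AdmQ W K p), n.Nonempty →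
    ∀ (m : Finset {ℓ // Zhang2014.IsKolyvaginPrime (W.conductorNorm ℤ) W K p ℓ}) (w : InfinitePlace K),
    κ m n ∈ selmerLocalKer (W.baseChange K) w.Completion ((p ^ 1 : ℕ) : ℤ)
  /-- property (1) at the level: TORIC at the places of `n`. -/
  toric_on : ∀ n : Finset (AdmQ W K p), n.Nonempty →
    ∀ m : Finset {ℓ // Zhang2014.IsKolyvaginPrime (W.conductorNorm ℤ) W K p ℓ}, ∀ q ∈ n,
    ∀ v : HeightOneSpectrum (𝓞 K),
    ((q : ℕ) : 𝓞 K) ∈ v.asIdeal → κ m n ∈ toricLocalKer (W.baseChange K) (v.adicCompletion K) ((p ^ 1 : ℕ) : ℤ)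
  /-- property (1) on the support: TRANSVERSE at the places of `m`. -/
  transverse_on : ∀ n : Finset (AdmQ W K p), n.Nonempty →
    ∀ m : Finset {ℓ // Zhang2014.IsKolyvaginPrime (W.conductorNorm ℤ) W K p ℓ}, ∀ ℓ ∈ m,
    ∀ v : HeightOneSpectrum (𝓞 K),
    ((ℓ : ℕ) : 𝓞 K) ∈ v.asIdeal → κ m n ∈ transverseLocalKerP W K p ι ℓ v
  /-- (8.1) as used: `loc_ℓ κ(mℓ, n) = 0 ⟺ loc_ℓ κ(m, n) = 0`. -/
  relation : ∀ n : Finset (AdmQ W K p), n.Nonempty →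
    ∀ (m : Finset {ℓ // Zhang2014.IsKolyvaginPrime (W.conductorNorm ℤ) W K p ℓ})
      (ℓ : {ℓ // Zhang2014.IsKolyvaginPrime (W.conductorNorm ℤ) W K p ℓ}), ℓ ∉ m → ∀ v : HeightOneSpectrum (𝓞 K),
    ((ℓ : ℕ) : 𝓞 K) ∈ v.asIdeal →
    (κ (insert ℓ m) n ∈ (W.baseChange K).torsionLocalKer (v.adicCompletion K) ((p ^ 1 : ℕ) : ℤ) ↔
      κ m n ∈ (W.baseChange K).torsionLocalKer (v.adicCompletion K) ((p ^ 1 : ℕ) : ℤ))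
  /-- (A2) congruence TRANSPORT along two steps (Zhang Thm 4.3, contrapositive form). -/
  transport : ∀ (n : Finset (AdmQ W K p)) (q₁ q₂ : AdmQ W K p),
    q₁ ∉ n → q₂ ∉ insert q₁ n → q₂ ∉ baseLocusQP W K p κ (insert q₂ (insert q₁ n)) → ∃ m, κ m n ≠ 0
  /-- (A5) BASE CASE at non-empty even levels of canonical rank one (Zhang Thm 7.2): `c(1, n) ≠ 0`. -/
  baseCase : ∀ n : Finset (AdmQ W K p), n.Nonempty → Even n.card →
    finrank (ZMod p) (SelQP W K p c n true) + finrank (ZMod p) (SelQP W K p c n false) = 1 → κ ∅ n ≠ 0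

end Summit.BirchSwinnertonDyer.BirchSwinnertonDyer.Theorems.AdditiveKoly

end
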